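import Summits.BirchSwinnertonDyer.BirchSwinnertonDyer.Theorems.ManinLocalTwoThreeThreeShiftHeisenbergDescent
import Summits.BirchSwinnertonDyer.BirchSwinnertonDyer.Theorems.ManinLocalTwoThreeDegeneracyUnitTwistKatoCurve
import HarnessLib

/-!
# The law E-es-68₉ REMOVED from the Kato-curve road at `p = 3`: `3 ∤ c(W)` on the squarefull `9 ∣ N` cell with NO PLUS DEFECT at `3`
# (reducible `W[3]` allowed) modulo ONLY Kato's printed symbol-closure fact F-es-18♭K — via (CD₉) `conjDefectLawNine_holds` and es's
# ORBIT CRITERION (route `ManinLocalTwoThree`, cell bsd-f2-manin; crux C3 `ManinPrimeToThreeAtNine` stmt-BirchSwinnertonDyer-22968;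
# prover seat p3 gen 11 — the `p = 3` twin of file IX of the 2-adic twin)

The seat's gen-9 file `…DegeneracyUnitTwistKatoCurve.lean` proved `3 ∤ D.c` at Kato's curve `E_K` (`IsSymbolClosureCurve VK D.f`, where
Kato's Theorem 12.5 is printed also for reducible `W[3]`) modulo the Literature fact F-es-18♭K `kato_isIntegral_twistedSymbolSum_three_symbolClosure`
AND the lattice law E-es-68₉ (`not_three_dvd_maninConstant_of_degeneracyLoopLawNine_symbolClosure`).  Since (CD₉) is a THEOREM
(`conjDefectLawNine_holds`, p1 g11, from E-es-94♯) and es's orbit criterion `DegeneracyOrbit.degeneracyClass_of_conjDefect` turns a unit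
conjugation defect of ratio `9` into the prime-class ratio-`9` degeneracy plus hypothesis, the f-specific hypothesis of the law-free entry
`not_three_dvd_maninConstant_of_degeneracyNinePlusIndex_symbolClosure` follows from `PlusIndexPrimeTo 3 D.f` ALONE:
**`degeneracyNinePlusIndex_of_plusIndexPrimeTo`**, **`not_three_dvd_maninConstant_of_plusIndexPrimeToThree_symbolClosure`** (+ the
composite-squarefull variant `'`: a prime `q ≠ 3` with `q² ∣ N` discharges the plus index by the Hecke sieve).  HONEST FRAMING: CONDITIONAL on
F-es-18♭K (printed, statement-only) and the Kato-curve binders; C3, Manin's conjecture and BSD are NOT proved.  No definitions, no sorry.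
[cite: Kato2004Asterisque, Thm. 12.5 (1) (p. 221) (the named fact F-es-18♭K, statement-only)]
-/

set_option linter.dupNamespace false
set_option autoImplicit false

noncomputable section

open scoped Classical MatrixGroups ModularForm ComplexConjugate

open CongruenceSubgroup Complex Literature.NumberTheory.EllipticCurves
  Literature.NumberTheory.EllipticCurves.ModularForms
  Summit.BirchSwinnertonDyer.Rank1Residual.ManinAdditive.Gamma1Lattice
  Summit.BirchSwinnertonDyer.Rank1Residual.ManinAdditive.KatoCurve
open Summit.BirchSwinnertonDyer.Rank1Residual.ManinAdditive.DegeneracyOrbit (degeneracyClass_iff_conjDefectUnit)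

namespace Summit.BirchSwinnertonDyer.BirchSwinnertonDyer.Theorems.ManinLocalTwoThree

/-- **the prime-to-3 ratio-9 degeneracy plus index, UNCONDITIONALLY** from `PlusIndexPrimeTo 3 f` at `9 ∣ N` ((CD₉)_holds + es's ORBIT
CRITERION + `closure` monotonicity from the prime-class loops to all loops). [new: composition of tree theorems] -/
theorem degeneracyNinePlusIndex_of_plusIndexPrimeTo {N : ℕ} [NeZero N] (f : CuspForm (Gamma0 N) 2) (hf : IsNewform0 f)
    (hQ : coeffField f = ⊥) (h9 : 3 ^ 2 ∣ N) (hpi : PlusIndexPrimeTo 3 f) :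
    ∀ x ∈ periodLattice f, ∃ y ∈ AddSubgroup.closure (degeneracyLoops f 9), ∃ k : ℕ, ¬ 3 ∣ k ∧
      (k : ℂ) * (x + conj x) = y + conj y := by
  have hclass := (degeneracyClass_iff_conjDefectUnit f hf hQ (t := 9) (by norm_num) ⟨3, rfl⟩).mpr
    (conjDefectLawNine_holds h9 f hf hQ hpi)
  intro x hx
  obtain ⟨y, hy, k, hk, hxy⟩ := hclass x hx
  exact ⟨y, AddSubgroup.closure_mono (degeneracyLoopsClassTwo_subset_degeneracyLoops f 9) hy, k, hk, hxy⟩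

/-- **`3 ∤ c(W)` at squarefull `9 ∣ N` with NO PLUS DEFECT at `3`, reducible `W[3]` allowed, modulo ONLY F-es-18♭K** (Kato at Kato's curve):
the plus index `PlusIndexPrimeTo 3 D.f` replaces the cell law E-es-68₉. CONDITIONAL on the displayed Literature fact and binders.
[cite: Kato2004Asterisque, Thm. 12.5 (1) (p. 221)] -/
theorem not_three_dvd_maninConstant_of_plusIndexPrimeToThree_symbolClosure
    (hF : kato_isIntegral_twistedSymbolSum_three_symbolClosure)
    (W : WeierstrassCurve ℚ) [W.IsElliptic] [W.IsGloballyMinimal] {N : ℕ} [NeZero N] (D : ModularParametrizationData W N)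
    (hadd : ¬ W.HasGoodReductionAtPrime 3 ∧ ¬ W.HasMultiplicativeReductionAtPrime 3)
    (hopt : ∀ z ∈ D.L.lattice, ∃ w ∈ periodLattice D.f, z = D.c * w)
    (h9 : 3 ^ 2 ∣ N) (hsq : ∀ ℓ ∈ N.primeFactors, ℓ ^ 2 ∣ N) (hpi : PlusIndexPrimeTo 3 D.f)
    (hpd : CuspidalPlusDefectPrimeTo 3 D)
    (VK : WeierstrassCurve ℚ) [VK.IsElliptic] [VK.IsGloballyMinimal] (hiso : WeierstrassCurve.IsIsogenous W VK)
    (hK : IsSymbolClosureCurve VK D.f) (hnewK : IsNewformOf VK D.f) (hgK : ¬ VK.HasGoodReductionAtPrime 3)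
    (hmK : ¬ VK.HasMultiplicativeReductionAtPrime 3) (haK : ∀ ℓ : ℕ, VK.LFunction ℓ = W.LFunction ℓ) :
    ¬ (3 : ℤ) ∣ D.c :=
  not_three_dvd_maninConstant_of_degeneracyNinePlusIndex_symbolClosure hF W D hadd hopt h9 hsq
    (degeneracyNinePlusIndex_of_plusIndexPrimeTo D.f D.isNewformOf.1 D.isNewformOf.coeffField_eq_bot h9 hpi)
    hpd VK hiso hK hnewK hgK hmK haK

/-- **Composite squarefull variant** (a prime `q ≠ 3` with `q² ∣ N` discharges the plus index by the Hecke sieve `plusIndexPrimeTo_of_sq_dvd`):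
`3 ∤ c(W)` modulo ONLY F-es-18♭K on the no-plus-defect composite-squarefull `9 ∣ N` cell. CONDITIONAL. [cite: Kato2004Asterisque, Thm. 12.5 (1) (p. 221)] -/
theorem not_three_dvd_maninConstant_of_plusIndexPrimeToThree_symbolClosure'
    (hF : kato_isIntegral_twistedSymbolSum_three_symbolClosure)
    (W : WeierstrassCurve ℚ) [W.IsElliptic] [W.IsGloballyMinimal] {N : ℕ} [NeZero N] (D : ModularParametrizationData W N)
    (hadd : ¬ W.HasGoodReductionAtPrime 3 ∧ ¬ W.HasMultiplicativeReductionAtPrime 3)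
    (hopt : ∀ z ∈ D.L.lattice, ∃ w ∈ periodLattice D.f, z = D.c * w)
    (h9 : 3 ^ 2 ∣ N) (hsq : ∀ ℓ ∈ N.primeFactors, ℓ ^ 2 ∣ N) {q : ℕ} (hq : q.Prime) (hq3 : q ≠ 3) (hqN : q ^ 2 ∣ N)
    (hpd : CuspidalPlusDefectPrimeTo 3 D)
    (VK : WeierstrassCurve ℚ) [VK.IsElliptic] [VK.IsGloballyMinimal] (hiso : WeierstrassCurve.IsIsogenous W VK)
    (hK : IsSymbolClosureCurve VK D.f) (hnewK : IsNewformOf VK D.f) (hgK : ¬ VK.HasGoodReductionAtPrime 3)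
    (hmK : ¬ VK.HasMultiplicativeReductionAtPrime 3) (haK : ∀ ℓ : ℕ, VK.LFunction ℓ = W.LFunction ℓ) :
    ¬ (3 : ℤ) ∣ D.c :=
  not_three_dvd_maninConstant_of_plusIndexPrimeToThree_symbolClosure hF W D hadd hopt h9 hsq
    (plusIndexPrimeTo_of_sq_dvd D.isNewformOf.1 hq hqN
      fun h ↦ hq3 ((Nat.prime_dvd_prime_iff_eq Nat.prime_three hq).mp h).symm)
    hpd VK hiso hK hnewK hgK hmK haK

end Summit.BirchSwinnertonDyer.BirchSwinnertonDyer.Theorems.ManinLocalTwoThree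

end
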